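import Literature.NumberTheory.Transcendental.KZDominatedFamily
import Literature.NumberTheory.Transcendental.KZLogCalculusProofs
import Summits.KontsevichZagierPeriods.KontsevichZagierPeriods.Theorems.LiouvilleUnfoldingCVSQuarter

/-!
# Route ValuedFieldSpecialisation — crux `ParametricLifting`: the Frullani sector,
domination of the blown-up family `D` and of the constant family `N`

Helper toward crux stmt-KontsevichZagierPeriods-3498 (`ParametricLifting`), line `registered`,
stubs `frullani_dominated_D` and `frullani_dominated_N` of the lead's Frullani calibration.
In coordinates `s = z 0 ∈ (0, 1/2)` (the parameter, base `G = {0 < y 0, 2 y 0 < 1}`) and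
`v = z 1` (the fibre variable), two families live on the CONSTANT band
`KZlog.band G 1 2 = {(s, v) | s ∈ G, 1 ≤ v ≤ 2}`:

* the blown-up family `D`, with integrand `1 / (v (1 + s v))` on its domain; its special fibre at
  `s → 0⁺` is `d₀ = ([1, 2], 1 / v)`, and `|1 / (v (1 + s v))| ≤ 1 / v` since `s v ≥ 0`, so `D` is
  dominated by `d₀` itself (`KZ.IsDominatedFamily D d₀ d₀`);
* the constant family `N`, with integrand `1 / (v (1 + v))`; its special fibre is
  `n₀ = ([1, 2], 1 / (v (1 + v)))` and `N` is dominated by `n₀` (`KZ.IsDominatedFamily N n₀ n₀`).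

We construct `d₀`, `n₀ : KZ.IntegralRep 1` (semialgebraic interval, rational integrands bounded on
a compact interval) and verify the three clauses of `KZ.IsDominatedFamily` (domination near
`s = 0⁺` with `ε = 1`, slice membership for every fibre point eventually as `s → 0⁺`, pointwise
convergence of the integrands).

Sources: M. Kontsevich, D. Zagier, *Periods* (2001), §1.2; G. Boros, V. Moll, *Irresistible
Integrals* (2004), §5.6 (Frullani); H. Lebesgue (dominated convergence). No new definitions.
-/

noncomputable section

namespace Summit.KontsevichZagierPeriods.ValuedFieldSpecialisation

open MeasureTheory Set Filter MvPolynomial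
open scoped Topology
open Literature.NumberTheory.Transcendental Literature.NumberTheory.Transcendental.KZ
open Literature.ModelTheory.ExponentialFields (IsSemialgebraic isSemialgebraic_setOf_eval_pos
  isSemialgebraic_setOf_eval_lt isSemialgebraic_setOf_eval_le)

/-! ### The constant band `{s ∈ G, 1 ≤ v ≤ 2}` and its fibre `[1, 2]` -/

/-- Membership in the constant band `{(s, v) | 0 < s, 2 s < 1, 1 ≤ v ≤ 2}` in coordinates.
[folklore] -/
theorem frullani_DN_mem_constBand {z : Fin (1 + 1) → ℝ} :
    z ∈ KZlog.band {y : Fin 1 → ℝ | 0 < y 0 ∧ 2 * y 0 < 1} (fun _ => 1) (fun _ => 2) ↔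
      (0 < z 0 ∧ 2 * z 0 < 1) ∧ 1 ≤ z 1 ∧ z 1 ≤ 2 :=
  Iff.rfl

/-- Slice membership in the constant band: `(s, x) ∈ {s ∈ G, 1 ≤ v ≤ 2}` iff `s ∈ G` and
`x ∈ [1, 2]`. [folklore] -/
theorem frullani_DN_vecCons_mem_constBand {s : ℝ} {x : Fin 1 → ℝ} :
    (Matrix.vecCons s x : Fin (1 + 1) → ℝ) ∈
        KZlog.band {y : Fin 1 → ℝ | 0 < y 0 ∧ 2 * y 0 < 1} (fun _ => 1) (fun _ => 2) ↔
      (0 < s ∧ 2 * s < 1) ∧ 1 ≤ x 0 ∧ x 0 ≤ 2 :=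
  Iff.rfl

/-- **Fibre representations on `[1, 2]`.** A function `f` on `ℝ¹` which on `[1, 2]` is the
reciprocal of a polynomial `q` with rational coefficients, `q ≠ 0` there, and which is continuous on
`[1, 2]`, yields an integral representation `([1, 2], f)` (semialgebraic graph; absolutely integrable
as a continuous function on a compact set; the interval `[1, 2] ⊆ ℝ¹` is the semialgebraic compact
base of the Cresson–Viu-Sos calibration, `LiouvilleUnfolding.Calibration.isSemialgebraic_base`).
[Kontsevich–Zagier 2001, §1.1] [folklore] -/
theorem frullani_DN_exists_fibreRep {f : (Fin 1 → ℝ) → ℝ} (q : MvPolynomial (Fin 1) ℚ)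
    (hq : ∀ x : Fin 1 → ℝ, 1 ≤ x 0 ∧ x 0 ≤ 2 → aeval x q ≠ 0)
    (hf : ∀ x : Fin 1 → ℝ, 1 ≤ x 0 ∧ x 0 ≤ 2 → f x = (aeval x q)⁻¹)
    (hcont : ContinuousOn f {x : Fin 1 → ℝ | 1 ≤ x 0 ∧ x 0 ≤ 2}) :
    ∃ r : KZ.IntegralRep 1, r.domain = {x : Fin 1 → ℝ | 1 ≤ x 0 ∧ x 0 ≤ 2} ∧ r.integrand = f := by
  have hσ := Summit.KontsevichZagierPeriods.LiouvilleUnfolding.Calibration.isSemialgebraic_base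
  have hsa : IsSemialgebraicFunOn ℚ {x : Fin 1 → ℝ | 1 ≤ x 0 ∧ x 0 ≤ 2} f :=
    (isSemialgebraicFunOn_aeval_div_aeval hσ 1 q hq).congr fun x hx => by
      dsimp only
      rw [map_one, one_div, hf x hx]
  have hint : IntegrableOn f {x : Fin 1 → ℝ | 1 ≤ x 0 ∧ x 0 ≤ 2} :=
    hcont.integrableOn_compact Summit.KontsevichZagierPeriods.LiouvilleUnfolding.Calibration.isCompact_base
  exact ⟨⟨{x : Fin 1 → ℝ | 1 ≤ x 0 ∧ x 0 ≤ 2}, f, hσ, hsa, hint⟩, rfl, rfl⟩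

/-- The special fibre `d₀ = ([1, 2], 1 / v)` of the blown-up family is an integral representation.
[Kontsevich–Zagier 2001, §1.1] [folklore] -/
theorem frullani_DN_exists_d₀ :
    ∃ d₀ : KZ.IntegralRep 1, d₀.domain = {x : Fin 1 → ℝ | 1 ≤ x 0 ∧ x 0 ≤ 2} ∧
      d₀.integrand = fun x => (x 0)⁻¹ := by
  refine frullani_DN_exists_fibreRep (X 0) (fun x hx => ?_) (fun x _ => ?_) ?_
  · rw [aeval_X]
    exact (one_pos.trans_le hx.1).ne'
  · rw [aeval_X]
  · exact (continuous_apply 0).continuousOn.inv₀ fun x hx => (one_pos.trans_le hx.1).ne'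

/-- The special fibre `n₀ = ([1, 2], 1 / (v (1 + v)))` of the constant family is an integral
representation. [Kontsevich–Zagier 2001, §1.1] [folklore] -/
theorem frullani_DN_exists_n₀ :
    ∃ n₀ : KZ.IntegralRep 1, n₀.domain = {x : Fin 1 → ℝ | 1 ≤ x 0 ∧ x 0 ≤ 2} ∧
      n₀.integrand = fun x => (x 0 * (1 + x 0))⁻¹ := by
  have hpos : ∀ x : Fin 1 → ℝ, 1 ≤ x 0 ∧ x 0 ≤ 2 → 0 < x 0 * (1 + x 0) := fun x hx =>
    mul_pos (one_pos.trans_le hx.1) (by linarith [hx.1])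
  refine frullani_DN_exists_fibreRep (X 0 * (1 + X 0)) (fun x hx => ?_) (fun x _ => ?_) ?_
  · rw [map_mul, map_add, map_one, aeval_X]
    exact (hpos x hx).ne'
  · rw [map_mul, map_add, map_one, aeval_X]
  · exact ((continuous_apply 0).mul (continuous_const.add (continuous_apply 0))).continuousOn.inv₀
      fun x hx => (hpos x hx).ne'

/-! ### The two dominated families -/

/-- **Stub F₂ (the blown-up family is dominated, special fibre `d₀ = ([1,2], 1/v)`).** On the
constant band `{0 < s, 2 s < 1, 1 ≤ v ≤ 2}` the family `D` with integrand `1 / (v (1 + s v))` is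
dominated near `s = 0⁺` by `d₀ = ([1, 2], 1 / v)` (`|1 / (v (1 + s v))| ≤ 1 / v` as `s v ≥ 0`),
every slice over `0 < s < 1/2` is `[1, 2]`, and `1 / (v (1 + s v)) → 1 / v` as `s → 0⁺`; so `d₀`
is its special fibre. [Kontsevich–Zagier 2001, §1.2; Lebesgue] [folklore] -/
theorem frullani_dominated_D :
    ∀ (D : KZ.IntegralRep (1 + 1)), D.domain = KZlog.band {y : Fin 1 → ℝ | 0 < y 0 ∧ 2 * y 0 < 1} (fun _ => 1) (fun _ => 2) → (∀ z ∈ D.domain, D.integrand z = (z 1 * (1 + z 0 * z 1))⁻¹) → ∃ d₀ : KZ.IntegralRep 1, d₀.domain = {x | 1 ≤ x 0 ∧ x 0 ≤ 2} ∧ (d₀.integrand = fun x => (x 0)⁻¹) ∧ KZ.IsDominatedFamily D d₀ d₀ := by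
  intro D hD hDi
  obtain ⟨d₀, hd₀d, hd₀i⟩ := frullani_DN_exists_d₀
  refine ⟨d₀, hd₀d, hd₀i, ⟨1, one_pos, fun z hz _ _ => ?_⟩, ?_, ?_⟩
  · -- clause (1): domination by `1 / v` near `s = 0⁺`
    have hz' : (0 < z 0 ∧ 2 * z 0 < 1) ∧ 1 ≤ z 1 ∧ z 1 ≤ 2 := by
      rw [hD] at hz
      exact frullani_DN_mem_constBand.mp hz
    have hv : 0 < z 1 := one_pos.trans_le hz'.2.1
    have hsv : 1 ≤ 1 + z 0 * z 1 := le_add_of_nonneg_right (mul_nonneg hz'.1.1.le hv.le)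
    refine ⟨?_, ?_⟩
    · rw [hd₀d]
      exact hz'.2
    · rw [hDi z hz, hd₀i, abs_of_pos (inv_pos.mpr (mul_pos hv (one_pos.trans_le hsv)))]
      exact inv_anti₀ hv (le_mul_of_one_le_right hv.le hsv)
  · -- clause (2): every slice over `0 < s < 1/2` is `[1, 2]`
    refine Eventually.of_forall fun x => ?_
    filter_upwards [Ioo_mem_nhdsGT (show (0 : ℝ) < 1 / 2 by norm_num)] with s hs
    rw [hD, frullani_DN_vecCons_mem_constBand, hd₀d]
    exact ⟨fun h => h.2, fun h => ⟨⟨hs.1, by linarith [hs.2]⟩, h⟩⟩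
  · -- clause (3): `1 / (v (1 + s v)) → 1 / v` as `s → 0⁺`
    refine Eventually.of_forall fun x hx => ?_
    rw [hd₀d] at hx
    have hx0 : 0 < x 0 := one_pos.trans_le hx.1
    have hlim : Tendsto (fun s : ℝ => (x 0 * (1 + s * x 0))⁻¹) (𝓝[>] 0) (𝓝 ((x 0)⁻¹)) := by
      have h1 : Tendsto (fun s : ℝ => x 0 * (1 + s * x 0)) (𝓝 0) (𝓝 (x 0 * (1 + 0 * x 0))) :=
        tendsto_const_nhds.mul (tendsto_const_nhds.add (tendsto_id.mul tendsto_const_nhds))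
      rw [zero_mul, add_zero, mul_one] at h1
      exact (h1.inv₀ hx0.ne').mono_left nhdsWithin_le_nhds
    rw [hd₀i]
    refine hlim.congr' ?_
    filter_upwards [Ioo_mem_nhdsGT (show (0 : ℝ) < 1 / 2 by norm_num)] with s hs
    have hmem : (Matrix.vecCons s x : Fin (1 + 1) → ℝ) ∈ D.domain := by
      rw [hD, frullani_DN_vecCons_mem_constBand]
      exact ⟨⟨hs.1, by linarith [hs.2]⟩, hx⟩
    rw [hDi _ hmem, Matrix.cons_val_one, Matrix.cons_val_zero, mul_comm s]

/-- **Stub F₃ (the constant family `N` is dominated, special fibre `n₀ = ([1,2], 1/(u(1+u)))`).**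
On the constant band `{0 < s, 2 s < 1, 1 ≤ u ≤ 2}` the family `N` with integrand `1 / (u (1 + u))`
(independent of `s`) is dominated near `s = 0⁺` by `n₀ = ([1, 2], 1 / (u (1 + u)))`, every slice
over `0 < s < 1/2` is `[1, 2]`, and the integrand is constant in `s`; so `n₀` is its special fibre.
[Kontsevich–Zagier 2001, §1.2; Lebesgue] [folklore] -/
theorem frullani_dominated_N :
    ∀ (N : KZ.IntegralRep (1 + 1)), N.domain = KZlog.band {y : Fin 1 → ℝ | 0 < y 0 ∧ 2 * y 0 < 1} (fun _ => 1) (fun _ => 2) → (N.integrand = fun z => (z 1 * (1 + z 1))⁻¹) → ∃ n₀ : KZ.IntegralRep 1, n₀.domain = {x | 1 ≤ x 0 ∧ x 0 ≤ 2} ∧ (n₀.integrand = fun x => (x 0 * (1 + x 0))⁻¹) ∧ KZ.IsDominatedFamily N n₀ n₀ := by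
  intro N hN hNi
  obtain ⟨n₀, hn₀d, hn₀i⟩ := frullani_DN_exists_n₀
  refine ⟨n₀, hn₀d, hn₀i, ⟨1, one_pos, fun z hz _ _ => ?_⟩, ?_, ?_⟩
  · -- clause (1): `|1 / (u (1 + u))| = 1 / (u (1 + u))`
    have hz' : (0 < z 0 ∧ 2 * z 0 < 1) ∧ 1 ≤ z 1 ∧ z 1 ≤ 2 := by
      rw [hN] at hz
      exact frullani_DN_mem_constBand.mp hz
    have hv : 0 < z 1 := one_pos.trans_le hz'.2.1
    refine ⟨?_, ?_⟩
    · rw [hn₀d]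
      exact hz'.2
    · rw [hNi, hn₀i, abs_of_pos (inv_pos.mpr (mul_pos hv (by linarith)))]
      exact le_rfl
  · -- clause (2): every slice over `0 < s < 1/2` is `[1, 2]`
    refine Eventually.of_forall fun x => ?_
    filter_upwards [Ioo_mem_nhdsGT (show (0 : ℝ) < 1 / 2 by norm_num)] with s hs
    rw [hN, frullani_DN_vecCons_mem_constBand, hn₀d]
    exact ⟨fun h => h.2, fun h => ⟨⟨hs.1, by linarith [hs.2]⟩, h⟩⟩
  · -- clause (3): the integrand does not depend on `s`
    refine Eventually.of_forall fun x _ => ?_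
    rw [hNi, hn₀i]
    simp only [Matrix.cons_val_one]
    exact tendsto_const_nhds

end Summit.KontsevichZagierPeriods.ValuedFieldSpecialisation
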